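import Summits.QuantumFields.YangMills.Theorems.UnitScaleTiltProp7CoverTwistedChartSym
import HarnessLib

/-!
# Route `UnitScaleTilt`, crux K1 «MinimiserStabilityRegPr» (stmt-QuantumFields-19200), EX row `hGF`, the (L6) LOD line — SMALL MEMBERS VIA THE COVER, ROW (c3):
# **THE TRANSFER DOOR — the cover member's curved target at `A∘π`, divided by the degree `(L^{jc})³`, IS the member's curved target with the SAME `γ`**
# (chair ★`ym-ust-19200-p1` g24 2026-08-30 03:25:11Z «LOCATE-SMALL-MEMBERS = {(c1), (c2), the 10-line transfer}»; (c2) displayed as the hypothesis `hc2` in the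
# INEQUALITY form pinned by the chair 03:35:31Z, so this door lands independently of the (c2) file and closes by `exact` when it lands)

Cell `ym3-torus` (HUMAN RULING D-0037, YM ladder rung R3 — YM₃ on T³ is a rung, NOT d = 4, NOT infinite volume, NOT a mass gap, NOT Clay; YM gap NOT proved), width seat
`ym3-torus-px17` (gen 9).  THEOREMS ONLY (0 `def`, 0 `sorry`, default heartbeats); `--supports stmt-QuantumFields-19200 --as helper`; count-neutral.

WHAT.  For a member `(F, n, K)`, a printed-regular background `W` (`0 < ε₀`, `10¹²L³ε₀ ≤ 1` — the `hT` binder's own windows), ANY `Q″` on the member and ANY `Q″′` on the cover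
member `F.cover jc` (✓`CoverSites.T3Family.cover`):
* `hcov` — the curved target ON THE COVER at the lifted background `W∘π` for every `A′`:
  `γ‖A′‖² ≤ re⟪A′, Δ^η(W∘π)A′⟫ + ‖projR(covLapSite (W∘π)) Q″′ (D*_{W∘π}A′)‖² + a·‖Qk (W∘π) A′‖²`, `a = a₀(c₀∕cB)(L^{K−n})³` (px10 g11's `curvedTarget_member` at the cover, which is
  a LARGE member: `m(F.cover jc) = m + jc`);
* `hc2` — row (c2) (routeR-w3 g13's pen, chair's pin 03:35:31Z): `‖projR(covLapSite (W∘π)) Q″′ (ỹ∘π)‖² ≤ (L^{jc})³·‖projR(covLapSite W) Q″ ỹ‖²` for every `ỹ`;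
conclude the curved target ON THE MEMBER for every `A` with the SAME `γ` and the same coefficient:
  ★★★ `curvedTarget_of_cover : ∀ A, γ‖A‖² ≤ re⟪A, Δ^η(W)A⟫ + ‖projR(covLapSite W) Q″ (D*_W A)‖² + a·‖Qk W A‖²`.
PROOF (the 10 lines): evaluate `hcov` at `A′ := toL2′(X∘π)`, `X := toL2⁻¹A`; the four slots are `(L^{jc})³ ×` the member's — ✓`norm_sq_toL2_cover` (px12 g7 F2b), ✓`DeltaEta_cover'` +
✓`inner_toL2_cover` (slot 1, exact), `hc2` at `ỹ := D*_W A` through ✓`DstarL2_cover'` (slot 2, `≤`), ✓`Prop7CoverTwistedChartSym.mul_norm_sq_Qk_cover` (slot 3, (c1), exact, on `RegPr`) — and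
divide by `(L^{jc})³ > 0`.
HONEST SCOPE.  A door: `hcov` (the cover member's target) and `hc2` (row (c2)) are HYPOTHESES; nothing of `hT` for small members, the window `γ > 0`, `hGF`, (3.49), EX
`stub_existenceMinimalOrbit`, the crux or the summit is proved here.

References: T. Bałaban, CMP **99** (1985) 389–434 [Balaban1985BackgroundPropagators] ((3.8)–(3.16) pp.392–393, (3.21) p.394, Thm 3.11 p.416); CMP **96** (1984) 223–250
[Balaban1984PropagatorsII] ((2.15)–(2.19) pp.225–226); CMP **109** (1987) 249–301 [Balaban1987RG1] ((0.1)–(0.2) pp.251–252).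
-/

set_option autoImplicit false

noncomputable section

open scoped InnerProductSpace Matrix.Norms.L2Operator BigOperators

namespace Summit.QuantumFields.YangMills.Theorems.Prop7CoverTargetTransfer

open Literature.MathematicalPhysics.QuantumFieldTheory.Balaban1983to89
open Literature.MathematicalPhysics.QuantumFieldTheory.Balaban1983to89.T3ContinuumYM3Torus
open T3PrintedRegularMinimiser (RegPr)
open B11Eq103H1Complex (SiteL2K BondL2K projR)
open CoverSites
open Summit.QuantumFields.YangMills.Theorems.Prop7SectET3Transport (periodsT3)
open Summit.QuantumFields.YangMills.Theorems.Prop7SectET3HilbertLetters (W₂ toL2 toL2S DstarL2 covLapSite)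
open Summit.QuantumFields.YangMills.Theorems.Prop7SectET3WilsonHessian (DeltaEta)
open Summit.QuantumFields.YangMills.Theorems.Prop7SectET3CurvedPropagators (Qk)
open Summit.QuantumFields.YangMills.Theorems.Prop7CoverHilbertPullback (norm_sq_toL2_cover inner_toL2_cover DeltaEta_cover' DstarL2_cover')
open Summit.QuantumFields.YangMills.Theorems.Prop7CoverTwistedChartSym (mul_norm_sq_Qk_cover)

variable (F : T3Family) (jc : ℕ) {n K : ℕ} (h : n ≤ K) (c₀ cB : ℝ) [Fact (0 < c₀)] [Fact (0 < cB)]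

/-- The degree `(L^{jc})³` is positive. [cite: Balaban1987RG1, (0.2) p.252] -/
theorem degree_pos : 0 < ((F.L : ℝ) ^ jc) ^ 3 := by
  have hL : (0 : ℝ) < F.L := by have := F.hL.2; exact_mod_cast (show 0 < F.L by omega)
  positivity

omit [Fact (0 < cB)] in
/-- ★ **SLOT 1 IS EXACT**: `re⟪Ã∘π, Δ^η(W∘π)(Ã∘π)⟫ = (L^{jc})³·re⟪Ã, Δ^η(W)Ã⟫` (✓`DeltaEta_cover'` + ✓`inner_toL2_cover`, read at `DeltaEta`). [cite: Balaban1985BackgroundPropagators, (3.12) p.392] -/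
theorem re_inner_DeltaEta_cover (W : GaugeField (F.P K) 0 (Matrix.specialUnitaryGroup (Fin 2) ℂ)) (X : PBond (F.P K) 0 → Matrix (Fin 2) (Fin 2) ℂ) :
    RCLike.re ⟪toL2 (F.cover jc) K c₀ (X ∘ projBond (F.P K) jc 0),
        DeltaEta (F.cover jc) n K c₀ (W ∘ projBond (F.P K) jc 0) (toL2 (F.cover jc) K c₀ (X ∘ projBond (F.P K) jc 0))⟫_ℂ
      = ((F.L : ℝ) ^ jc) ^ 3 * RCLike.re ⟪toL2 F K c₀ X, DeltaEta F n K c₀ W (toL2 F K c₀ X)⟫_ℂ := by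
  rw [DeltaEta_cover', inner_toL2_cover, LinearEquiv.apply_symm_apply, RCLike.re_to_complex, RCLike.re_to_complex, Complex.mul_re]
  simp only [Complex.natCast_re, Complex.natCast_im, zero_mul, sub_zero]
  push_cast; ring

omit [Fact (0 < cB)] in
/-- ★ **SLOT 2 UNDER ROW (c2)**: if `‖projR(covLapSite (W∘π)) Q″′ (ỹ∘π)‖² ≤ (L^{jc})³·‖projR(covLapSite W) Q″ ỹ‖²` for every `ỹ`, then at `ỹ := D*_W Ã` (✓`DstarL2_cover'`)
`‖projR(covLapSite (W∘π)) Q″′ (D*_{W∘π}(Ã∘π))‖² ≤ (L^{jc})³·‖projR(covLapSite W) Q″ (D*_W Ã)‖²`. [cite: Balaban1985BackgroundPropagators, (3.8) p.392, (3.21) p.394] -/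
theorem projR_DstarL2_cover_le (W : GaugeField (F.P K) 0 (Matrix.specialUnitaryGroup (Fin 2) ℂ))
    (Q'' : SiteL2K ℂ 3 (periodsT3 F K) c₀ W₂ →ₗ[ℂ] (Site (F.P K) (K - n) → Matrix (Fin 2) (Fin 2) ℂ))
    (Q''c : SiteL2K ℂ 3 (periodsT3 (F.cover jc) K) c₀ W₂ →ₗ[ℂ] (Site ((F.cover jc).P K) (K - n) → Matrix (Fin 2) (Fin 2) ℂ))
    (hc2 : ∀ y : SiteL2K ℂ 3 (periodsT3 F K) c₀ W₂,
      ‖projR (covLapSite (F.cover jc) n K c₀ (W ∘ projBond (F.P K) jc 0)) Q''c (toL2S (F.cover jc) K c₀ (((toL2S F K c₀).symm y) ∘ proj (F.P K) jc 0))‖ ^ 2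
        ≤ ((F.L : ℝ) ^ jc) ^ 3 * ‖projR (covLapSite F n K c₀ W) Q'' y‖ ^ 2)
    (X : PBond (F.P K) 0 → Matrix (Fin 2) (Fin 2) ℂ) :
    ‖projR (covLapSite (F.cover jc) n K c₀ (W ∘ projBond (F.P K) jc 0)) Q''c
        (DstarL2 (F.cover jc) n K c₀ (W ∘ projBond (F.P K) jc 0) (toL2 (F.cover jc) K c₀ (X ∘ projBond (F.P K) jc 0)))‖ ^ 2
      ≤ ((F.L : ℝ) ^ jc) ^ 3 * ‖projR (covLapSite F n K c₀ W) Q'' (DstarL2 F n K c₀ W (toL2 F K c₀ X))‖ ^ 2 := by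
  rw [DstarL2_cover']
  exact hc2 _

/-- ★★★ **ROW (c3) — THE TRANSFER DOOR**: the cover member's curved target at `W∘π` (`hcov`, every `A′`) and row (c2) (`hc2`, every `ỹ`) give the member's curved target at `W`
for every `A`, with the SAME `γ` and the same coefficient `a₀(c₀∕cB)(L^{K−n})³` (`0 < ε₀`, `10¹²L³ε₀ ≤ 1`, `W ∈ RegPr F n K ε₀` — the windows of ✓(c1) `mul_norm_sq_Qk_cover`).
[cite: Balaban1985BackgroundPropagators, (3.8)-(3.16) pp.392-393, (3.21) p.394, Thm 3.11 p.416; Balaban1987RG1, (0.1)-(0.2) pp.251-252] -/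
theorem curvedTarget_of_cover {ε₀ : ℝ} (hε₀ : 0 < ε₀) (hWε : 10 ^ 12 * (F.L : ℝ) ^ 3 * ε₀ ≤ 1)
    (W : GaugeField (F.P K) 0 (Matrix.specialUnitaryGroup (Fin 2) ℂ)) (hreg : RegPr F n K ε₀ W)
    (Q'' : SiteL2K ℂ 3 (periodsT3 F K) c₀ W₂ →ₗ[ℂ] (Site (F.P K) (K - n) → Matrix (Fin 2) (Fin 2) ℂ))
    (Q''c : SiteL2K ℂ 3 (periodsT3 (F.cover jc) K) c₀ W₂ →ₗ[ℂ] (Site ((F.cover jc).P K) (K - n) → Matrix (Fin 2) (Fin 2) ℂ))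
    (γ a₀ : ℝ)
    (hcov : ∀ A' : BondL2K ℂ 3 (periodsT3 (F.cover jc) K) c₀ W₂,
      γ * ‖A'‖ ^ 2 ≤ RCLike.re ⟪A', DeltaEta (F.cover jc) n K c₀ (W ∘ projBond (F.P K) jc 0) A'⟫_ℂ
        + ‖projR (covLapSite (F.cover jc) n K c₀ (W ∘ projBond (F.P K) jc 0)) Q''c (DstarL2 (F.cover jc) n K c₀ (W ∘ projBond (F.P K) jc 0) A')‖ ^ 2
        + (a₀ * (c₀ / cB) * (((F.cover jc).L : ℝ) ^ (K - n)) ^ 3) * ‖Qk (F.cover jc) n K h c₀ cB (W ∘ projBond (F.P K) jc 0) A'‖ ^ 2)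
    (hc2 : ∀ y : SiteL2K ℂ 3 (periodsT3 F K) c₀ W₂,
      ‖projR (covLapSite (F.cover jc) n K c₀ (W ∘ projBond (F.P K) jc 0)) Q''c (toL2S (F.cover jc) K c₀ (((toL2S F K c₀).symm y) ∘ proj (F.P K) jc 0))‖ ^ 2
        ≤ ((F.L : ℝ) ^ jc) ^ 3 * ‖projR (covLapSite F n K c₀ W) Q'' y‖ ^ 2) :
    ∀ A : BondL2K ℂ 3 (periodsT3 F K) c₀ W₂,
      γ * ‖A‖ ^ 2 ≤ RCLike.re ⟪A, DeltaEta F n K c₀ W A⟫_ℂ + ‖projR (covLapSite F n K c₀ W) Q'' (DstarL2 F n K c₀ W A)‖ ^ 2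
        + (a₀ * (c₀ / cB) * ((F.L : ℝ) ^ (K - n)) ^ 3) * ‖Qk F n K h c₀ cB W A‖ ^ 2 := by
  intro A
  -- read `A` as a bond function and lift it
  obtain ⟨X, rfl⟩ := (toL2 F K c₀).surjective A
  have hdeg := degree_pos F jc
  have h0 := hcov (toL2 (F.cover jc) K c₀ (X ∘ projBond (F.P K) jc 0))
  -- the four slots of the cover inequality, in member currency
  rw [norm_sq_toL2_cover, re_inner_DeltaEta_cover, mul_norm_sq_Qk_cover F jc h hε₀ hWε a₀ W hreg X] at h0
  have h2 := projR_DstarL2_cover_le F jc c₀ W Q'' Q''c hc2 X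
  -- divide by the degree
  have h3 : ((F.L : ℝ) ^ jc) ^ 3 * (γ * ‖toL2 F K c₀ X‖ ^ 2)
      ≤ ((F.L : ℝ) ^ jc) ^ 3 * (RCLike.re ⟪toL2 F K c₀ X, DeltaEta F n K c₀ W (toL2 F K c₀ X)⟫_ℂ
          + ‖projR (covLapSite F n K c₀ W) Q'' (DstarL2 F n K c₀ W (toL2 F K c₀ X))‖ ^ 2
          + (a₀ * (c₀ / cB) * ((F.L : ℝ) ^ (K - n)) ^ 3) * ‖Qk F n K h c₀ cB W (toL2 F K c₀ X)‖ ^ 2) := by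
    have e1 : γ * ((((F.L : ℝ) ^ jc) ^ 3) * ‖toL2 F K c₀ X‖ ^ 2) = ((F.L : ℝ) ^ jc) ^ 3 * (γ * ‖toL2 F K c₀ X‖ ^ 2) := by ring
    rw [e1] at h0
    linarith [h0, h2]
  exact le_of_mul_le_mul_left h3 hdeg

end Summit.QuantumFields.YangMills.Theorems.Prop7CoverTargetTransfer

end
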